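import Summits.QuantumFields.YangMills.Theorems.F4SubCurvatureDoorShellSeparationWeightedLines
import Summits.QuantumFields.YangMills.Theorems.F4SubCurvatureDoorFibreDichotomyHarmonicMomentOffOrigin
import Summits.QuantumFields.YangMills.Theorems.F4SubCurvatureDoorFibreDichotomyPolyIsometry
import Summits.QuantumFields.YangMills.Theorems.F4SubCurvatureDoorFibreDichotomyShellLFAnalytic
import Summits.QuantumFields.YangMills.Theorems.F4SubCurvatureDoorRationalToGeneralLaplacianMultiplier
import Mathlib
import HarnessLib

/-!
# LINE g21-A/g21-B (⟨stmt-QuantumFields-23125⟩) — S2 helper: the iterated SHIFTED LAPLACIAN of a Laplace–Fourier kernel is the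
# Laplace–Fourier integral weighted by powers of the shifted mass squared

Helper toward the registered stub S2 `stub_shellSeparation`.  Step (2) of the shell-separation mechanism for ALL orders: if `K` is smooth off
the origin and `K(y) = ∫ e^{−y₀E} cos⟪q⃗, y⃗⟫ dμ` on the open half-space `{y₀ > 0}`, where `μ` is carried by `E ≥ 0`, Laplace-integrable,
with `‖q⃗‖ ≤ E + A` a.e., then for every `k` and every `y` with `y₀ > 0`

  `((Δ + Q₀)^k K)(y) = ∫ (E² − ‖q⃗‖² + Q₀)^k e^{−y₀E} cos⟪q⃗, y⃗⟫ dμ`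

(`shiftedLaplacian_iterate_eq`; `Δ` is Mathlib's Laplacian).  Also: `Δ` (hence `(Δ + Q₀)^k`) commutes with every linear isometry for
ARBITRARY functions (`shiftedLaplacian_iterate_comp_iso`), so `(Δ + Q₀)^k K` inherits the `D₄`-invariance of `K`; and smoothness off the origin
propagates (`contDiffAt_shiftedLaplacian_iterate`).

Mathlib + tree only; no `sorry`; no new definitions.  HONEST LABEL: calculus helper for a registered stub of an OPEN line; S1, S2, ⟨23125⟩,
⟨23035⟩, R2d and the Yang–Mills mass gap remain OPEN; no summit is proved by a line.
-/

noncomputable section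

open MeasureTheory Set Filter Topology InnerProductSpace
open scoped BigOperators Laplacian ContDiff

namespace Summit.QuantumFields.YangMills.Theorems.F4SubCurvatureDoorShellSeparationProof

open Summit.QuantumFields.YangMills.Theorems.F4SubCurvatureDoorLaplaceFourierRegistered (E4 E3 timeSpace)
open Summit.QuantumFields.YangMills.Theorems.F4SubCurvatureDoorFibreDichotomyAxis (spacePart)
open Summit.QuantumFields.YangMills.Theorems.F4SubCurvatureDoorShellLFAnalytic (massSq spacePart_apply)
open Summit.QuantumFields.YangMills.Theorems.F4SubCurvatureDoorSmearedSlices (ae_nonneg_of_measure_Iio)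
open Summit.QuantumFields.YangMills.Theorems.F4SubCurvatureDoorLaplacianMultiplierRegistered (iteratedFDeriv_two_eq_of_line
  inner_add_smul_single)
open Summit.QuantumFields.YangMills.Theorems.F4SubCurvatureDoorHarmonicMomentODE (laplacian_eq_sum_iteratedFDeriv_single
  laplacian_comp_linearIsometryEquiv)

variable {μ : Measure (ℝ × E3)}

/-! ## Equivariance and smoothness of the iterated shifted Laplacian -/

/-- **`(Δ + Q₀)^k` commutes with linear isometries** (for arbitrary functions; no regularity needed). -/
theorem shiftedLaplacian_iterate_comp_iso (R : E4 ≃ₗᵢ[ℝ] E4) (Q₀ : ℝ) (k : ℕ) (f : E4 → ℝ) :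
    (fun g : E4 → ℝ => fun x => (Δ g) x + Q₀ * g x)^[k] (f ∘ R) =
      ((fun g : E4 → ℝ => fun x => (Δ g) x + Q₀ * g x)^[k] f) ∘ R := by
  induction k with
  | zero => rfl
  | succ k ih =>
    rw [Function.iterate_succ_apply', Function.iterate_succ_apply', ih]
    funext x
    simp only [Function.comp_apply]
    rw [laplacian_comp_linearIsometryEquiv]

/-- A function invariant under `R` has `R`-invariant iterated shifted Laplacians. -/
theorem shiftedLaplacian_iterate_invariant {f : E4 → ℝ} {R : E4 ≃ₗᵢ[ℝ] E4} (hf : ∀ x, f (R x) = f x) (Q₀ : ℝ) (k : ℕ) (x : E4) :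
    ((fun g : E4 → ℝ => fun x => (Δ g) x + Q₀ * g x)^[k] f) (R x) = ((fun g : E4 → ℝ => fun x => (Δ g) x + Q₀ * g x)^[k] f) x := by
  have hfR : f ∘ R = f := funext hf
  have h := shiftedLaplacian_iterate_comp_iso R Q₀ k f
  rw [hfR] at h
  exact (congrFun h x).symm

/-- **Smoothness off the origin propagates** to the iterated shifted Laplacians. -/
theorem contDiffAt_shiftedLaplacian_iterate {f : E4 → ℝ} (hf : ∀ x : E4, x ≠ 0 → ContDiffAt ℝ ⊤ f x) (Q₀ : ℝ) (k : ℕ) :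
    ∀ x : E4, x ≠ 0 → ContDiffAt ℝ ⊤ ((fun g : E4 → ℝ => fun x => (Δ g) x + Q₀ * g x)^[k] f) x := by
  induction k with
  | zero => exact hf
  | succ k ih =>
    intro x hx
    rw [Function.iterate_succ_apply']
    set g := (fun g : E4 → ℝ => fun x => (Δ g) x + Q₀ * g x)^[k] f with hg
    have hg2 : ContDiffAt ℝ ⊤ (iteratedFDeriv ℝ 2 g) x := (ih x hx).iteratedFDeriv_right (i := 2) (m := ⊤) le_top
    have hΔ : ContDiffAt ℝ ⊤ (Δ g) x := by
      rw [laplacian_eq_iteratedFDeriv_orthonormalBasis g (EuclideanSpace.basisFun (Fin 4) ℝ)]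
      refine ContDiffAt.sum fun i _ => ?_
      exact (ContinuousMultilinearMap.apply ℝ (fun _ : Fin 2 => E4) ℝ _).contDiff.contDiffAt.comp x hg2
    exact hΔ.add (contDiffAt_const.mul (ih x hx))

/-! ## The mass weights -/

/-- `massSq` is continuous. -/
theorem continuous_massSq : Continuous (massSq : ℝ × E3 → ℝ) := by
  unfold massSq
  fun_prop

/-- **Growth of the shifted mass powers**: `|(massSq + Q₀)^k| ≤ C^k (1+E)^{2k}` a.e. with `C = 2(1+A)² + |Q₀|`. -/
theorem massPow_bound (h0 : μ (Set.Iio (0 : ℝ) ×ˢ (Set.univ : Set E3)) = 0) {A : ℝ} (hA : 0 ≤ A)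
    (hq : ∀ᵐ p ∂μ, ‖p.2‖ ≤ p.1 + A) (Q₀ : ℝ) (k : ℕ) :
    ∀ᵐ p ∂μ, |(massSq p + Q₀) ^ k| ≤ (2 * (1 + A) ^ 2 + |Q₀|) ^ k * (1 + p.1) ^ (2 * k) := by
  filter_upwards [hq, ae_nonneg_of_measure_Iio μ h0] with p hpq hE
  have h1 : |massSq p + Q₀| ≤ (2 * (1 + A) ^ 2 + |Q₀|) * (1 + p.1) ^ 2 := by
    have hm : |massSq p| ≤ 2 * (1 + A) ^ 2 * (1 + p.1) ^ 2 := by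
      have hn : 0 ≤ ‖p.2‖ := norm_nonneg _
      have hq2 : ‖p.2‖ ^ 2 ≤ (p.1 + A) ^ 2 := pow_le_pow_left₀ hn hpq 2
      have hEA : p.1 + A ≤ (1 + A) * (1 + p.1) := by nlinarith
      have h3 : (p.1 + A) ^ 2 ≤ ((1 + A) * (1 + p.1)) ^ 2 := pow_le_pow_left₀ (by positivity) hEA 2
      have h4 : p.1 ^ 2 ≤ ((1 + A) * (1 + p.1)) ^ 2 := pow_le_pow_left₀ hE (by nlinarith) 2
      rw [mul_pow] at h3 h4
      rw [massSq, abs_le]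
      constructor <;> nlinarith
    calc |massSq p + Q₀| ≤ |massSq p| + |Q₀| := abs_add_le _ _
      _ ≤ 2 * (1 + A) ^ 2 * (1 + p.1) ^ 2 + |Q₀| * (1 + p.1) ^ 2 := by
          have : |Q₀| ≤ |Q₀| * (1 + p.1) ^ 2 := le_mul_of_one_le_right (abs_nonneg _) (by nlinarith)
          linarith
      _ = (2 * (1 + A) ^ 2 + |Q₀|) * (1 + p.1) ^ 2 := by ring
  rw [abs_pow, pow_mul, ← mul_pow]
  exact pow_le_pow_left₀ (abs_nonneg _) h1 k

/-! ## Coordinates along the frame lines -/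

/-- Moving along `e₀` changes only the time coordinate. -/
theorem line_zero (y : E4) (r : ℝ) :
    (y + r • EuclideanSpace.single (0 : Fin 4) (1 : ℝ)) 0 = y 0 + r ∧
      spacePart (y + r • EuclideanSpace.single (0 : Fin 4) (1 : ℝ)) = spacePart y := by
  refine ⟨by simp, ?_⟩
  ext j
  simp [spacePart_apply, Fin.succ_ne_zero]

/-- Moving along `e_{j+1}` changes only the `j`-th spatial coordinate. -/
theorem line_succ (y : E4) (r : ℝ) (j : Fin 3) :
    (y + r • EuclideanSpace.single j.succ (1 : ℝ)) 0 = y 0 ∧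
      spacePart (y + r • EuclideanSpace.single j.succ (1 : ℝ)) = spacePart y + r • EuclideanSpace.single j (1 : ℝ) := by
  refine ⟨by simp [(Fin.succ_ne_zero j).symm], ?_⟩
  ext i
  simp [spacePart_apply, Fin.succ_inj]

/-! ## The induction step: the Laplacian of a weighted Laplace–Fourier integral -/

/-- **Laplacian of a weighted Laplace–Fourier integral.**  Let `W` be a measurable weight with `|W| ≤ C(1+E)^m` a.e. and
`Φ(y) = ∫ W e^{−y₀E} cos⟪q⃗, y⃗⟫ dμ`.  If `Φ` is `C²` at a point `y` with `y₀ > 0`, then `Δ Φ (y) = ∫ W · (E² − ‖q⃗‖²) e^{−y₀E} cos⟪q⃗, y⃗⟫ dμ`. -/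
theorem laplacian_weightedLF (h0 : μ (Set.Iio (0 : ℝ) ×ˢ (Set.univ : Set E3)) = 0)
    (hint : ∀ t : ℝ, 0 < t → Integrable (fun p : ℝ × E3 => Real.exp (-(t * p.1))) μ)
    {A : ℝ} (hA : 0 ≤ A) (hq : ∀ᵐ p ∂μ, ‖p.2‖ ≤ p.1 + A)
    {W : ℝ × E3 → ℝ} (hWm : Measurable W) {C : ℝ} {m : ℕ} (hC : 0 ≤ C) (hWb : ∀ᵐ p ∂μ, |W p| ≤ C * (1 + p.1) ^ m)
    {y : E4} (hy : 0 < y 0)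
    (hΦ : ContDiffAt ℝ 2 (fun x : E4 => ∫ p, W p * Real.exp (-(x 0 * p.1)) * Real.cos (inner ℝ p.2 (spacePart x)) ∂μ) y) :
    (Δ fun x : E4 => ∫ p, W p * Real.exp (-(x 0 * p.1)) * Real.cos (inner ℝ p.2 (spacePart x)) ∂μ) y =
      ∫ p, W p * massSq p * Real.exp (-(y 0 * p.1)) * Real.cos (inner ℝ p.2 (spacePart y)) ∂μ := by
  set t := y 0 with ht
  set z := spacePart y with hz
  have hcos : ∀ u : ℝ, |Real.cos u| ≤ 1 := Real.abs_cos_le_one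
  have hsin : ∀ u : ℝ, |(-Real.sin u)| ≤ 1 := fun u => by rw [abs_neg]; exact Real.abs_sin_le_one u
  have hncos : ∀ u : ℝ, |(-Real.cos u)| ≤ 1 := fun u => by rw [abs_neg]; exact Real.abs_cos_le_one u
  -- the time direction
  have hWE : ∀ᵐ p ∂μ, |(-(W p * p.1))| ≤ C * (1 + p.1) ^ (m + 1) := by
    filter_upwards [weight_mul_energy h0 hC hWb] with p hp
    rwa [abs_neg]
  have d0 : iteratedFDeriv ℝ 2 (fun x : E4 => ∫ p, W p * Real.exp (-(x 0 * p.1)) * Real.cos (inner ℝ p.2 (spacePart x)) ∂μ) y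
      (fun _ => EuclideanSpace.single (0 : Fin 4) (1 : ℝ)) =
      ∫ p, (-(W p * p.1)) * p.1 * Real.exp (-(t * p.1)) * (-Real.cos (inner ℝ p.2 z)) ∂μ := by
    have hgm : Measurable fun p : ℝ × E3 => Real.cos (inner ℝ p.2 z) := by fun_prop
    -- first derivative along the time line, valid for all `r > -t`
    have h1 : ∀ r : ℝ, -t / 2 < r → HasDerivAt
        (fun r : ℝ => ∫ p, W p * Real.exp (-((t + r) * p.1)) * Real.cos (inner ℝ p.2 z) ∂μ)
        (-∫ p, W p * p.1 * Real.exp (-((t + r) * p.1)) * Real.cos (inner ℝ p.2 z) ∂μ) r := by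
      intro r hr
      have htr : 0 < t + r := by linarith
      have h := hasDerivAt_weight_time h0 hint hWm hC hWb hgm (fun p => hcos _) htr
      have hlin : HasDerivAt (fun r : ℝ => t + r) 1 r := by simpa using (hasDerivAt_id r).const_add t
      have := h.comp r hlin
      simpa [Function.comp_def] using this
    refine iteratedFDeriv_two_eq_of_line hΦ (φ' := fun r => -∫ p, W p * p.1 * Real.exp (-((t + r) * p.1)) * Real.cos (inner ℝ p.2 z) ∂μ)
      ?_ ?_
    · filter_upwards [Ioi_mem_nhds (show -t / 2 < (0 : ℝ) by linarith)] with r hr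
      have e : (fun r : ℝ => ∫ p, W p * Real.exp (-((y + r • EuclideanSpace.single (0 : Fin 4) (1 : ℝ)) 0 * p.1)) *
          Real.cos (inner ℝ p.2 (spacePart (y + r • EuclideanSpace.single (0 : Fin 4) (1 : ℝ)))) ∂μ) =
          fun r : ℝ => ∫ p, W p * Real.exp (-((t + r) * p.1)) * Real.cos (inner ℝ p.2 z) ∂μ := by
        funext r
        rw [(line_zero y r).1, (line_zero y r).2]
      rw [e]
      exact h1 r hr
    · -- second derivative at `0`: differentiate `r ↦ -∫ W E e^{−(t+r)E} cos = ∫ (−W E) e^{−(t+r)E} cos`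
      have hWEm : Measurable fun p : ℝ × E3 => -(W p * p.1) := (hWm.mul measurable_fst).neg
      have h2 := hasDerivAt_weight_time h0 hint hWEm hC hWE hgm (fun p => hcos _) hy
      have hlin : HasDerivAt (fun r : ℝ => t + r) 1 0 := by simpa using (hasDerivAt_id (0 : ℝ)).const_add t
      have h2' : HasDerivAt (fun s : ℝ => ∫ p, (-(W p * p.1)) * Real.exp (-(s * p.1)) * Real.cos (inner ℝ p.2 z) ∂μ)
          (-∫ p, (-(W p * p.1)) * p.1 * Real.exp (-(t * p.1)) * Real.cos (inner ℝ p.2 z) ∂μ) (t + 0) := by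
        rw [add_zero]; exact h2
      have h3 := h2'.comp (0 : ℝ) hlin
      have e : (fun r : ℝ => -∫ p, W p * p.1 * Real.exp (-((t + r) * p.1)) * Real.cos (inner ℝ p.2 z) ∂μ) =
          (fun s : ℝ => ∫ p, (-(W p * p.1)) * Real.exp (-(s * p.1)) * Real.cos (inner ℝ p.2 z) ∂μ) ∘ fun r : ℝ => t + r := by
        funext r
        simp only [Function.comp_apply, ← integral_neg]
        refine integral_congr_ae (ae_of_all _ fun p => by ring)
      rw [e]
      refine h3.congr_deriv ?_
      rw [mul_one, ← integral_neg]
      exact integral_congr_ae (ae_of_all _ fun p => by ring)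
  -- the spatial directions
  have dj : ∀ j : Fin 3, iteratedFDeriv ℝ 2
      (fun x : E4 => ∫ p, W p * Real.exp (-(x 0 * p.1)) * Real.cos (inner ℝ p.2 (spacePart x)) ∂μ) y
      (fun _ => EuclideanSpace.single j.succ (1 : ℝ)) =
      ∫ p, W p * p.2 j * p.2 j * Real.exp (-(t * p.1)) * (-Real.cos (inner ℝ p.2 z + 0 * p.2 j)) ∂μ := by
    intro j
    have hqj : Measurable fun p : ℝ × E3 => p.2 j := by fun_prop
    have hWj := weight_mul_momentum h0 hA hq hC hWb j
    have h1 : ∀ r : ℝ, HasDerivAt (fun r : ℝ => ∫ p, W p * Real.exp (-(t * p.1)) * Real.cos (inner ℝ p.2 z + r * p.2 j) ∂μ)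
        (∫ p, W p * p.2 j * Real.exp (-(t * p.1)) * (-Real.sin (inner ℝ p.2 z + r * p.2 j)) ∂μ) r := fun r =>
      hasDerivAt_weight_space h0 hint hA hq hWm hC hWb Real.cos (fun u => -Real.sin u) (fun u => Real.hasDerivAt_cos u)
        Real.continuous_cos (Real.continuous_sin.neg) (fun u => hcos u) hsin hy z j r
    refine iteratedFDeriv_two_eq_of_line hΦ
      (φ' := fun r => ∫ p, W p * p.2 j * Real.exp (-(t * p.1)) * (-Real.sin (inner ℝ p.2 z + r * p.2 j)) ∂μ) ?_ ?_
    · refine Eventually.of_forall fun r => ?_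
      have e : (fun r : ℝ => ∫ p, W p * Real.exp (-((y + r • EuclideanSpace.single j.succ (1 : ℝ)) 0 * p.1)) *
          Real.cos (inner ℝ p.2 (spacePart (y + r • EuclideanSpace.single j.succ (1 : ℝ)))) ∂μ) =
          fun r : ℝ => ∫ p, W p * Real.exp (-(t * p.1)) * Real.cos (inner ℝ p.2 z + r * p.2 j) ∂μ := by
        funext r
        rw [(line_succ y r j).1, (line_succ y r j).2]
        simp_rw [inner_add_smul_single]
        rfl
      rw [e]
      exact h1 r
    · have h2 := hasDerivAt_weight_space h0 hint hA hq (hWm.mul hqj) (C := C * (1 + A)) (m := m + 1) (by positivity) hWj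
        (fun u => -Real.sin u) (fun u => -Real.cos u) (fun u => (Real.hasDerivAt_sin u).neg) Real.continuous_sin.neg
        Real.continuous_cos.neg hsin hncos hy z j 0
      exact h2
  -- sum over the frame
  rw [laplacian_eq_sum_iteratedFDeriv_single, Fin.sum_univ_succ, d0]
  simp_rw [dj]
  -- integrability of the four pieces, then linearity of the integral
  have hgm : Measurable fun p : ℝ × E3 => -Real.cos (inner ℝ p.2 z) := by fun_prop
  have hi0 : Integrable (fun p : ℝ × E3 => (-(W p * p.1)) * p.1 * Real.exp (-(t * p.1)) * (-Real.cos (inner ℝ p.2 z))) μ := by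
    have hb : ∀ᵐ p ∂μ, |(-(W p * p.1)) * p.1| ≤ C * (1 + p.1) ^ (m + 1 + 1) := weight_mul_energy h0 hC hWE
    exact integrable_weight h0 hint (((hWm.mul measurable_fst).neg).mul measurable_fst) hb hgm (fun p => hncos _) hy
  have hij : ∀ j : Fin 3, Integrable
      (fun p : ℝ × E3 => W p * p.2 j * p.2 j * Real.exp (-(t * p.1)) * (-Real.cos (inner ℝ p.2 z + 0 * p.2 j))) μ := by
    intro j
    have hqj : Measurable fun p : ℝ × E3 => p.2 j := by fun_prop
    have hb := weight_mul_momentum h0 hA hq (C := C * (1 + A)) (m := m + 1) (by positivity) (weight_mul_momentum h0 hA hq hC hWb j) j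
    exact integrable_weight h0 hint ((hWm.mul hqj).mul hqj) hb (by fun_prop) (fun p => hncos _) hy
  rw [← integral_finsetSum _ (fun j _ => hij j), ← integral_add hi0 (integrable_finsetSum _ fun j _ => hij j)]
  refine integral_congr_ae (ae_of_all _ fun p => ?_)
  simp only [zero_mul, add_zero, massSq]
  have hn : ‖p.2‖ ^ 2 = ∑ j : Fin 3, p.2 j * p.2 j := by
    rw [EuclideanSpace.norm_sq_eq]
    exact Finset.sum_congr rfl fun j _ => by rw [Real.norm_eq_abs, sq_abs, sq]
  rw [hn]
  have e2 : ∑ j : Fin 3, W p * p.2 j * p.2 j * Real.exp (-(t * p.1)) * -Real.cos (inner ℝ p.2 z) =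
      (-(W p * Real.exp (-(t * p.1)) * Real.cos (inner ℝ p.2 z))) * ∑ j : Fin 3, p.2 j * p.2 j := by
    rw [Finset.mul_sum]
    exact Finset.sum_congr rfl fun j _ => by ring
  rw [e2]
  ring

/-! ## The iterated identity -/

/-- **`((Δ + Q₀)^k K)(y) = ∫ (massSq + Q₀)^k e^{−y₀E} cos⟪q⃗, y⃗⟫ dμ` on the open half-space `{y₀ > 0}`**, for `K` smooth off the origin with
the Laplace–Fourier representation there. -/
theorem shiftedLaplacian_iterate_eq (h0 : μ (Set.Iio (0 : ℝ) ×ˢ (Set.univ : Set E3)) = 0)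
    (hint : ∀ t : ℝ, 0 < t → Integrable (fun p : ℝ × E3 => Real.exp (-(t * p.1))) μ)
    {A : ℝ} (hA : 0 ≤ A) (hq : ∀ᵐ p ∂μ, ‖p.2‖ ≤ p.1 + A) (Q₀ : ℝ)
    {K : E4 → ℝ} (hKs : ∀ x : E4, x ≠ 0 → ContDiffAt ℝ ⊤ K x)
    (hrep : ∀ y : E4, 0 < y 0 → K y = ∫ p, Real.exp (-(y 0 * p.1)) * Real.cos (inner ℝ p.2 (spacePart y)) ∂μ)
    (k : ℕ) : ∀ y : E4, 0 < y 0 →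
      ((fun g : E4 → ℝ => fun x => (Δ g) x + Q₀ * g x)^[k] K) y =
        ∫ p, (massSq p + Q₀) ^ k * Real.exp (-(y 0 * p.1)) * Real.cos (inner ℝ p.2 (spacePart y)) ∂μ := by
  induction k with
  | zero =>
    intro y hy
    rw [Function.iterate_zero_apply, hrep y hy]
    exact integral_congr_ae (ae_of_all _ fun p => by simp)
  | succ k ih =>
    intro y hy
    rw [Function.iterate_succ_apply']
    set G := (fun g : E4 → ℝ => fun x => (Δ g) x + Q₀ * g x)^[k] K with hG
    set Φ : E4 → ℝ := fun x => ∫ p, (massSq p + Q₀) ^ k * Real.exp (-(x 0 * p.1)) * Real.cos (inner ℝ p.2 (spacePart x)) ∂μ with hΦ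
    -- `G = Φ` near `y`
    have hopen : IsOpen {x : E4 | 0 < x 0} := isOpen_lt continuous_const (by fun_prop)
    have hev : G =ᶠ[𝓝 y] Φ := by
      filter_upwards [hopen.mem_nhds hy] with x hx
      exact ih x hx
    have hy0 : y ≠ 0 := fun h => by rw [h] at hy; exact lt_irrefl _ hy
    have hGs : ContDiffAt ℝ 2 G y := ((contDiffAt_shiftedLaplacian_iterate hKs Q₀ k) y hy0).of_le le_top
    have hΦs : ContDiffAt ℝ 2 Φ y := hGs.congr_of_eventuallyEq hev.symm
    -- the weight `(massSq + Q₀)^k`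
    have hWm : Measurable fun p : ℝ × E3 => (massSq p + Q₀) ^ k := (continuous_massSq.add continuous_const).measurable.pow_const k
    have hC : 0 ≤ (2 * (1 + A) ^ 2 + |Q₀|) ^ k := by positivity
    have hWb := massPow_bound h0 hA hq Q₀ k
    have hΔ := laplacian_weightedLF h0 hint hA hq hWm hC hWb hy hΦs
    show (Δ G) y + Q₀ * G y = _
    rw [(laplacian_congr_nhds hev).eq_of_nhds, ih y hy]
    change (Δ Φ) y + Q₀ * Φ y = _
    rw [hΔ, hΦ]
    dsimp only
    have hi1 : Integrable (fun p : ℝ × E3 => (massSq p + Q₀) ^ k * massSq p * Real.exp (-(y 0 * p.1)) *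
        Real.cos (inner ℝ p.2 (spacePart y))) μ := by
      have hb : ∀ᵐ p ∂μ, |(massSq p + Q₀) ^ k * massSq p| ≤ (2 * (1 + A) ^ 2 + |Q₀|) ^ k * (2 * (1 + A) ^ 2 + |(0 : ℝ)|) ^ 1 *
          (1 + p.1) ^ (2 * k + 2 * 1) := by
        filter_upwards [hWb, massPow_bound h0 hA hq 0 1, ae_nonneg_of_measure_Iio μ h0] with p h1 h2 hE
        rw [abs_mul, pow_add]
        simp only [add_zero, pow_one] at h2 ⊢
        calc |(massSq p + Q₀) ^ k| * |massSq p| ≤ (2 * (1 + A) ^ 2 + |Q₀|) ^ k * (1 + p.1) ^ (2 * k) *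
            ((2 * (1 + A) ^ 2 + |(0:ℝ)|) * (1 + p.1) ^ 2) := mul_le_mul h1 h2 (abs_nonneg _) (by positivity)
          _ = _ := by ring
      exact integrable_weight h0 hint (hWm.mul continuous_massSq.measurable) hb (by fun_prop) (fun p => Real.abs_cos_le_one _) hy
    have hi2 : Integrable (fun p : ℝ × E3 => (massSq p + Q₀) ^ k * Real.exp (-(y 0 * p.1)) * Real.cos (inner ℝ p.2 (spacePart y))) μ :=
      integrable_weight h0 hint hWm hWb (by fun_prop) (fun p => Real.abs_cos_le_one _) hy
    rw [← integral_const_mul, ← integral_add hi1 (hi2.const_mul Q₀)]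
    refine integral_congr_ae (ae_of_all _ fun p => ?_)
    dsimp only
    rw [pow_succ]
    ring

end Summit.QuantumFields.YangMills.Theorems.F4SubCurvatureDoorShellSeparationProof

end
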